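import Literature.Geometry.DiscreteGeometry.ThreePointEnergyBound
import Literature.Geometry.DiscreteGeometry.ThreePointKernelDimThree
import Summits.Ventures.PackingBounds.Energy.FivePointQuarticSOS
import HarnessLib

/-!
# Five points on `S²`: the sharp bound `99/8` for `Σ (1 + ⟪x,y⟫)^4` by an exact three-point certificate

Framing: lottery ticket; floor = certified bounds/negative ranges. Venture `PackingBounds`, cell
`pub-packcert`, energy family E3PT (pub-packcert-energy gen 11).

For every set `C` of five unit vectors of `ℝ³`, `Σ (1 + ⟪x,y⟫)^4` over ordered pairs is at least `99/8`, the value of the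
triangular bipyramid. (Statement in the range of R. E. Schwartz's computer-assisted five-point theorems; the proof here is a
sharp Bachoc–Vallentin / Cohn–Woo three-point certificate with exact data, kernel-checked: `CohnWoo.energy_ge_of_threePoint`,
`tripleSum_threePointF3_nonneg`, the SOS identities of the companion files, and the potential itself.)
Source certificate `pub-packcert-energy/certs/e3pt/e3pt-sharp-n3N5ck4d4.json`; generator `code/e3pt/g11/e3pt_lean.py`.
-/

noncomputable section

open Finset
open scoped RealInnerProductSpace

namespace Summit.Ventures.PackingBounds.Energy.FivePointQuartic

open Literature.Geometry.DiscreteGeometry Literature.Geometry.DiscreteGeometry.BachocVallentin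
open Literature.Analysis.SpecialFunctions

/-- Two-point coefficients (`a_0 = 0`, `a_1 = a1KQ4`). -/
def acoKQ4 : ℕ → ℝ
  | 1 => a1KQ4
  | _ => 0

/-- `a₁ ≥ 0`. -/
theorem a1_nonnegQ4 : 0 ≤ a1KQ4 := by unfold a1KQ4; exact kval_nonnegQ4 _ _ _ _ (by norm_num)

/-- The two-point coefficients are nonnegative. -/
theorem aco_nonnegQ4 (k : ℕ) : 0 ≤ acoKQ4 k := by
  unfold acoKQ4; split
  · exact a1_nonnegQ4
  · norm_num

/-- The rank-one weights are nonnegative. -/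
theorem dco_nonnegQ4 (k r : ℕ) : 0 ≤ dcoKQ4 k r := by
  unfold dcoKQ4; split <;> first | exact kval_nonnegQ4 _ _ _ _ (by norm_num) | norm_num

/-- `chebHom 2` unfolded. -/
private theorem chebHom_2 (xQ4 wQ4 : ℝ) : chebHom 2 xQ4 wQ4 = xQ4 * (xQ4 / 2) - wQ4 * (1) := by
  simp [chebHom]

/-- `chebHom 3` unfolded. -/
private theorem chebHom_3 (xQ4 wQ4 : ℝ) : chebHom 3 xQ4 wQ4 = xQ4 * (xQ4 * (xQ4 / 2) - wQ4 * (1)) - wQ4 * (xQ4 / 2) := by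
  simp [chebHom]

set_option maxRecDepth 20000 in
set_option maxHeartbeats 400000000 in
/-- The tree's factored three-point function equals `FexpKQ4` (`ring`; `ℚ(√2,√3)` weights enter linearly). -/
theorem threePointF3_eqQ4 (u v t : ℝ) : threePointF3 4 4 dcoKQ4 gwKQ4 u v t = FexpKQ4 u v t := by
  simp only [threePointF3, Finset.sum_range_succ, Finset.sum_range_zero, sym6, Q3, dcoKQ4, gwKQ4, chebHom_2, chebHom_3,
    zero_add, zero_mul, add_zero]
  simp only [chebHom, FexpKQ4]
  ring

/-- The value of the bound: `5(4c - F(1,1,1) - a₁) = 99/8` (the bipyramid's energy over ordered pairs). -/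
theorem bound_eqQ4 : (5 : ℝ) * ((5 - 1) * c0KQ4 - FexpKQ4 1 1 1 - a1KQ4 * 1) = ((99 : ℝ)/8) := by
  unfold c0KQ4 FexpKQ4 a1KQ4; ring

/-- **Five points on `S²` (sharp three-point bound).** For every five unit vectors `C ⊂ ℝ³`, `Σ (1 + ⟪x,y⟫)^4` over ordered
pairs is `≥ 99/8`, the value of the triangular bipyramid. -/
theorem ck4_five_points (C : Finset (EuclideanSpace ℝ (Fin 3))) (hC : ∀ x ∈ C, ‖x‖ = 1)
    (h5 : C.card = 5) :
    ((99 : ℝ)/8) ≤ ∑ x ∈ C, ∑ y ∈ C.erase x, (1 + inner ℝ x y) ^ 4 := by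
  classical
  have hA := pairSum_gegenbauer_comb_nonneg (n := 3) (by norm_num) 1 acoKQ4 aco_nonnegQ4 C hC
  have hF := tripleSum_threePointF3_nonneg 4 4 dcoKQ4 dco_nonnegQ4 gwKQ4 C hC
  have hcard : (C.card : ℝ) = 5 := by exact_mod_cast h5
  have hAeval : ∀ w : ℝ, (∑ k ∈ range (1 + 1), acoKQ4 k * gegenbauerSum ((((3 : ℕ) : ℝ) - 2) / 2) k w)
      = a1KQ4 * w := by
    intro w
    have h0 : acoKQ4 0 = 0 := rfl
    have h1 : acoKQ4 1 = a1KQ4 := rfl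
    simp only [Finset.sum_range_succ, Finset.sum_range_zero, h0, h1, gegenbauerSum_one, gegenbauerSum_zero]
    push_cast
    ring
  have hineq : ∀ u v t : ℝ, -1 ≤ u → u < 1 → -1 ≤ v → v < 1 → -1 ≤ t → t < 1 →
      0 ≤ 1 + 2 * u * v * t - u ^ 2 - v ^ 2 - t ^ 2 →
      c0KQ4 + ((C.card : ℝ) - 2) * threePointF3 4 4 dcoKQ4 gwKQ4 u v t + threePointF3 4 4 dcoKQ4 gwKQ4 u u 1
        + threePointF3 4 4 dcoKQ4 gwKQ4 v v 1 + threePointF3 4 4 dcoKQ4 gwKQ4 t t 1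
        + ((fun w => ∑ k ∈ range (1 + 1), acoKQ4 k * gegenbauerSum ((((3 : ℕ) : ℝ) - 2) / 2) k w) u
          + (fun w => ∑ k ∈ range (1 + 1), acoKQ4 k * gegenbauerSum ((((3 : ℕ) : ℝ) - 2) / 2) k w) v
          + (fun w => ∑ k ∈ range (1 + 1), acoKQ4 k * gegenbauerSum ((((3 : ℕ) : ℝ) - 2) / 2) k w) t) / 3
        ≤ (pminKQ4 u + pminKQ4 v + pminKQ4 t) / 3 := by
    intro u v t hu1 hu2 hv1 hv2 ht1 ht2 hdet
    simp only [hAeval, hcard, threePointF3_eqQ4]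
    have h1 := slack_nonnegQ4 u v t hu1 hu2.le hv1 hv2.le ht1 ht2.le hdet
    linarith
  have key := CohnWoo.energy_ge_of_threePoint C hC (by omega) pminKQ4 _ _ c0KQ4 hA hF
    (threePointF3_swap12 4 4 dcoKQ4 gwKQ4) (threePointF3_swap23 4 4 dcoKQ4 gwKQ4) hineq
  simp only [hAeval, hcard, threePointF3_eqQ4] at key
  rw [bound_eqQ4] at key
  refine key.trans (le_of_eq (Finset.sum_congr rfl fun x _ => Finset.sum_congr rfl fun y _ => ?_))
  simp only [pminKQ4]; ring

end Summit.Ventures.PackingBounds.Energy.FivePointQuartic
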